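import Summits.CriticalPhenomena.PercolationContinuityZ3.Theorems.Transplant.FKConnectivityAllQAntipodalX2Pos
import HarnessLib

/-!
# Connectivity correlation inequalities for `φ_{w,q}` — the SPLIT up-correlation functional `U¹¹` is stable under series/parallel
# composition with unmarked parts; hence `U¹¹ ≥ 0` (`0 < q ≤ 1`) for every network grown from a pendant core `y·M`

Theorem file (`--supports stmt-CriticalPhenomena-4575`), FK sub-lane `prim-bschramm-fk-2` (gen 14); builds on p205010 (kernel theorem,
internal audit signed; external expert review pending).  No definitions, no named facts, no sorries; standard axioms.

`apUpcSplit q E s t y z h = ∑_{γ ⊆ E, |γ ∩ {y,z}| = 1} q^{k(γ)+k(E∖γ)} (1{s↔t in γ} - 1{s↔t in E∖γ}) h(γ)` (`…AntipodalSplitSeries`) is the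
antipodal up-correlation functional `apUpc` of `…AntipodalDefs` against the test function `splitInd y z · h` (`FK.apUpcSplit_eq_apUpc`).
Hence the composition laws of `apUpc` (`FK.apUpc_parallel_eq`, `FK.apUpc_series_eq`, gen 11) transport it: if the marked edges `y, z`
lie in one part `M₁` of a composition with an unmarked part `M₂ ⊆ E₂`, `E₂` two-terminal series–parallel, then
`q^{2|V|}·U¹¹(M₁ ∘ M₂; h)` is a nonnegative combination of `U¹¹(M₁; h(· ∪ γ₂))` over `γ₂ ⊆ M₂` and of `splitInd(γ₁)·apUpc(M₂; h(γ₁ ∪ ·)) ≥ 0`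
(Theorem U) over `γ₁ ⊆ M₁` (`FK.apUpcSplit_parallel_nonneg`, `FK.apUpcSplit_series_left_nonneg`, `FK.apUpcSplit_series_right_nonneg`)
— memo g11 §3.9 ("U¹¹ propagates through every composition keeping `y, z` in one part").  Along a spine (`FK.IsSpine`, gen 14) this
gives `FK.IsSpine.apUpcSplit_nonneg`: the property "`U¹¹(h) ≥ 0` for every `h` monotone on the sub-configurations and not reading `y, z`"
passes from an inner composite to every network grown from it by gluing two-terminal series–parallel parts; with the pendant core
`y·M` of `FK.apUpcSplit_pendant_nonneg` (gen 14, from `FK.ApX2Pos`): **`FK.apUpcSplit_nonneg_of_pendant_core`** — `U¹¹ ≥ 0` for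
`0 < q ≤ 1` on every network obtained from `y·M` (`M` TTSP with the second marked edge `z ∈ M`, `y` a pendant edge in series at a
terminal) by further series/parallel compositions, i.e. whenever the lowest node of the decomposition tree containing both marked
edges is a series node with the single edge `y` as a child (memo g12 §5(2): the general split node remains open).
[cite: Grimmett2006, §1.4 eq. (1.20) (p. 15); §3.8 Thm. (3.90) (pp. 61–62); §3.9 (p. 63)]
-/

noncomputable section

namespace Summit.CriticalPhenomena.PercolationContinuityZ3.Theorems

namespace FK

open SimpleGraph Literature.Probability.LatticeModels Literature.Probability.Percolation X2Word
open scoped Classical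

variable {V : Type*}

/-! ### `U¹¹` as `apUpc` against `splitInd · h`; small tools -/

/-- **`apUpcSplit` is `apUpc` against the test function `splitInd y z · h`.** [folklore] -/
theorem apUpcSplit_eq_apUpc (q : ℝ) (E : Finset (Sym2 V)) (s t : V) (y z : Sym2 V) (h : Finset (Sym2 V) → ℝ) :
    apUpcSplit q E s t y z h = apUpc q E s t (fun γ => splitInd y z γ * h γ) := by
  unfold apUpcSplit apUpc
  refine Finset.sum_congr rfl fun γ _ => ?_
  ring

/-- `apUpc` only reads the test function on the sub-configurations. [folklore] -/
theorem apUpc_congr (q : ℝ) {M : Finset (Sym2 V)} (s t : V) {h h' : Finset (Sym2 V) → ℝ} (hh : ∀ γ ⊆ M, h γ = h' γ) :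
    apUpc q M s t h = apUpc q M s t h' := by
  unfold apUpc
  refine Finset.sum_congr rfl fun γ hγ => ?_
  rw [hh γ (Finset.mem_powerset.1 hγ)]

/-- `apUpc` is homogeneous in the test function. [folklore] -/
theorem apUpc_const_mul (q : ℝ) (M : Finset (Sym2 V)) (s t : V) (c : ℝ) (h : Finset (Sym2 V) → ℝ) :
    apUpc q M s t (fun γ => c * h γ) = c * apUpc q M s t h := by
  unfold apUpc
  rw [Finset.mul_sum]
  refine Finset.sum_congr rfl fun γ _ => ?_
  ring

/-- The split indicator only reads the marked edges: adding edges other than `y, z` does not change it. [folklore] -/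
theorem splitInd_union_right {y z : Sym2 V} {γ₁ γ₂ : Finset (Sym2 V)} (hy : y ∉ γ₂) (hz : z ∉ γ₂) :
    splitInd y z (γ₁ ∪ γ₂) = splitInd y z γ₁ := by
  unfold splitInd
  simp only [Finset.mem_union, hy, hz, or_false]

/-- The same with the unmarked part on the left. [folklore] -/
theorem splitInd_union_left {y z : Sym2 V} {γ₁ γ₂ : Finset (Sym2 V)} (hy : y ∉ γ₁) (hz : z ∉ γ₁) :
    splitInd y z (γ₁ ∪ γ₂) = splitInd y z γ₂ := by
  rw [Finset.union_comm]; exact splitInd_union_right hy hz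

/-- The split indicator is nonnegative. [folklore] -/
theorem splitInd_nonneg (y z : Sym2 V) (γ : Finset (Sym2 V)) : 0 ≤ splitInd y z γ := by
  unfold splitInd; split_ifs <;> norm_num

/-- A test function not reading `y, z`: sections keep the property. [folklore] -/
theorem notRead_section {y z : Sym2 V} {h : Finset (Sym2 V) → ℝ} (hhy : ∀ A, h (insert y A) = h A) (hhz : ∀ A, h (insert z A) = h A)
    (γ₂ : Finset (Sym2 V)) :
    (∀ A, (fun γ₁ => h (γ₁ ∪ γ₂)) (insert y A) = (fun γ₁ => h (γ₁ ∪ γ₂)) A) ∧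
      (∀ A, (fun γ₁ => h (γ₁ ∪ γ₂)) (insert z A) = (fun γ₁ => h (γ₁ ∪ γ₂)) A) := by
  refine ⟨fun A => ?_, fun A => ?_⟩
  · show h (insert y A ∪ γ₂) = h (A ∪ γ₂); rw [Finset.insert_union, hhy]
  · show h (insert z A ∪ γ₂) = h (A ∪ γ₂); rw [Finset.insert_union, hhz]

/-- The same for sections on the other side. [folklore] -/
theorem notRead_section' {y z : Sym2 V} {h : Finset (Sym2 V) → ℝ} (hhy : ∀ A, h (insert y A) = h A) (hhz : ∀ A, h (insert z A) = h A)
    (γ₁ : Finset (Sym2 V)) :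
    (∀ A, (fun γ₂ => h (γ₁ ∪ γ₂)) (insert y A) = (fun γ₂ => h (γ₁ ∪ γ₂)) A) ∧
      (∀ A, (fun γ₂ => h (γ₁ ∪ γ₂)) (insert z A) = (fun γ₂ => h (γ₁ ∪ γ₂)) A) := by
  refine ⟨fun A => ?_, fun A => ?_⟩
  · show h (γ₁ ∪ insert y A) = h (γ₁ ∪ A); rw [Finset.union_insert, hhy]
  · show h (γ₁ ∪ insert z A) = h (γ₁ ∪ A); rw [Finset.union_insert, hhz]

/-! ### Composition with an unmarked part -/

section Compose

variable [Fintype V] {E₁ E₂ : Finset (Sym2 V)} {V₁ V₂ : Set V} {y z : Sym2 V} {q : ℝ}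

/-- **Parallel composition with an unmarked part** (marked edges in `M₁`): if `U¹¹(M₁; h') ≥ 0` for every `h'` monotone on the subsets of
`M₁` and not reading `y, z`, and `apUpc(M₂; ·) ≥ 0` on monotone test functions (Theorem U), then `U¹¹(M₁ ⊔ M₂; h) ≥ 0` for every `h`
monotone on the subsets of `M₁ ⊔ M₂` and not reading `y, z` (`q > 0`). [cite: Grimmett2006, §3.8 Thm. (3.90) (pp. 61–62)] -/
theorem apUpcSplit_parallel_nonneg {s t : V} (hq : 0 < q) (hd : Disjoint E₁ E₂) (h₁ : ∀ e ∈ (↑E₁ : Set (Sym2 V)), ∀ x ∈ e, x ∈ V₁)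
    (h₂ : ∀ e ∈ (↑E₂ : Set (Sym2 V)), ∀ x ∈ e, x ∈ V₂) (hS : V₁ ∩ V₂ ⊆ {s, t}) (hst : s ≠ t)
    {M₁ M₂ : Finset (Sym2 V)} (hM₁ : M₁ ⊆ E₁) (hM₂ : M₂ ⊆ E₂) (hy : y ∉ E₂) (hz : z ∉ E₂)
    (ih₁ : ∀ h' : Finset (Sym2 V) → ℝ, (∀ ⦃A B : Finset (Sym2 V)⦄, A ⊆ B → B ⊆ M₁ → h' A ≤ h' B) →
      (∀ A, h' (insert y A) = h' A) → (∀ A, h' (insert z A) = h' A) → 0 ≤ apUpcSplit q M₁ s t y z h')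
    (ih₂ : ∀ h' : Finset (Sym2 V) → ℝ, (∀ ⦃A B : Finset (Sym2 V)⦄, A ⊆ B → B ⊆ M₂ → h' A ≤ h' B) → 0 ≤ apUpc q M₂ s t h')
    {h : Finset (Sym2 V) → ℝ} (hmono : ∀ ⦃A B : Finset (Sym2 V)⦄, A ⊆ B → B ⊆ M₁ ∪ M₂ → h A ≤ h B)
    (hhy : ∀ A, h (insert y A) = h A) (hhz : ∀ A, h (insert z A) = h A) :
    0 ≤ apUpcSplit q (M₁ ∪ M₂) s t y z h := by
  rw [apUpcSplit_eq_apUpc]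
  have key := apUpc_parallel_eq q hd h₁ h₂ hS hst hM₁ hM₂ (fun γ => splitInd y z γ * h γ)
  have hpos : 0 < q ^ (2 * Fintype.card V) := pow_pos hq _
  refine (mul_nonneg_iff_of_pos_left hpos).1 ?_
  rw [key]
  refine add_nonneg (Finset.sum_nonneg fun γ₂ hγ₂ => ?_) (Finset.sum_nonneg fun γ₁ hγ₁ => ?_)
  · rw [Finset.mem_powerset] at hγ₂
    have hy₂ : y ∉ γ₂ := fun hh => hy (hM₂ (hγ₂ hh))
    have hz₂ : z ∉ γ₂ := fun hh => hz (hM₂ (hγ₂ hh))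
    have hc0 := apConn_nonneg γ₂ s t
    have hc1 := apConn_le_one γ₂ s t
    have hd0 := apConn_nonneg (M₂ \ γ₂) s t
    have hd1 := apConn_le_one (M₂ \ γ₂) s t
    have hsec : apUpc q M₁ s t (fun γ₁ => splitInd y z (γ₁ ∪ γ₂) * h (γ₁ ∪ γ₂)) =
        apUpcSplit q M₁ s t y z (fun γ₁ => h (γ₁ ∪ γ₂)) := by
      rw [apUpcSplit_eq_apUpc]
      exact apUpc_congr q s t fun γ₁ _ => by rw [splitInd_union_right hy₂ hz₂]
    rw [hsec]
    obtain ⟨sy, sz⟩ := notRead_section hhy hhz γ₂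
    refine mul_nonneg (pow_nonneg hq.le _) (mul_nonneg ?_ (ih₁ _ (fun A B hAB hB => ?_) sy sz))
    · exact add_nonneg (mul_nonneg (sub_nonneg.2 hc1) (sub_nonneg.2 hd1))
        (mul_nonneg hq.le (mul_nonneg (sub_nonneg.2 hc1) hd0))
    · exact hmono (Finset.union_subset_union hAB le_rfl) (Finset.union_subset_union hB hγ₂)
  · rw [Finset.mem_powerset] at hγ₁
    have hc0 := apConn_nonneg γ₁ s t
    have hc1 := apConn_le_one γ₁ s t
    have hd0 := apConn_nonneg (M₁ \ γ₁) s t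
    have hd1 := apConn_le_one (M₁ \ γ₁) s t
    have hsec : apUpc q M₂ s t (fun γ₂ => splitInd y z (γ₁ ∪ γ₂) * h (γ₁ ∪ γ₂)) =
        splitInd y z γ₁ * apUpc q M₂ s t (fun γ₂ => h (γ₁ ∪ γ₂)) := by
      rw [← apUpc_const_mul]
      refine apUpc_congr q s t fun γ₂ hγ₂ => ?_
      rw [splitInd_union_right (fun hh => hy (hM₂ (hγ₂ hh))) (fun hh => hz (hM₂ (hγ₂ hh)))]
    rw [hsec]
    refine mul_nonneg (pow_nonneg hq.le _) (mul_nonneg ?_ (mul_nonneg (splitInd_nonneg y z γ₁)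
      (ih₂ _ fun A B hAB hB => ?_)))
    · exact add_nonneg (mul_nonneg (sub_nonneg.2 hc1) (sub_nonneg.2 hd1))
        (mul_nonneg hq.le (mul_nonneg hc0 (sub_nonneg.2 hd1)))
    · exact hmono (Finset.union_subset_union le_rfl hAB) (Finset.union_subset_union hγ₁ hB)

/-- **Series composition with an unmarked part on the right** (marked edges in the `(a, m)`-part `M₁`). [cite: Grimmett2006, §3.8 Thm. (3.90) (pp. 61–62)] -/
theorem apUpcSplit_series_left_nonneg {a m b : V} (hq : 0 < q) (hd : Disjoint E₁ E₂)
    (h₁ : ∀ e ∈ (↑E₁ : Set (Sym2 V)), ∀ x ∈ e, x ∈ V₁) (h₂ : ∀ e ∈ (↑E₂ : Set (Sym2 V)), ∀ x ∈ e, x ∈ V₂)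
    (hS : V₁ ∩ V₂ ⊆ {m}) (haV₂ : a ∉ V₂) (hbV₁ : b ∉ V₁) (ham : a ≠ m) (hbm : b ≠ m) (hab : a ≠ b)
    {M₁ M₂ : Finset (Sym2 V)} (hM₁ : M₁ ⊆ E₁) (hM₂ : M₂ ⊆ E₂) (hy : y ∉ E₂) (hz : z ∉ E₂)
    (ih₁ : ∀ h' : Finset (Sym2 V) → ℝ, (∀ ⦃A B : Finset (Sym2 V)⦄, A ⊆ B → B ⊆ M₁ → h' A ≤ h' B) →
      (∀ A, h' (insert y A) = h' A) → (∀ A, h' (insert z A) = h' A) → 0 ≤ apUpcSplit q M₁ a m y z h')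
    (ih₂ : ∀ h' : Finset (Sym2 V) → ℝ, (∀ ⦃A B : Finset (Sym2 V)⦄, A ⊆ B → B ⊆ M₂ → h' A ≤ h' B) → 0 ≤ apUpc q M₂ m b h')
    {h : Finset (Sym2 V) → ℝ} (hmono : ∀ ⦃A B : Finset (Sym2 V)⦄, A ⊆ B → B ⊆ M₁ ∪ M₂ → h A ≤ h B)
    (hhy : ∀ A, h (insert y A) = h A) (hhz : ∀ A, h (insert z A) = h A) :
    0 ≤ apUpcSplit q (M₁ ∪ M₂) a b y z h := by
  rw [apUpcSplit_eq_apUpc]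
  have key := apUpc_series_eq q hd h₁ h₂ hS haV₂ hbV₁ ham hbm hab hM₁ hM₂ (fun γ => splitInd y z γ * h γ)
  have hpos : 0 < q ^ (2 * Fintype.card V) := pow_pos hq _
  refine (mul_nonneg_iff_of_pos_left hpos).1 ?_
  rw [key]
  refine add_nonneg (Finset.sum_nonneg fun γ₂ hγ₂ => ?_) (Finset.sum_nonneg fun γ₁ hγ₁ => ?_)
  · rw [Finset.mem_powerset] at hγ₂
    have hy₂ : y ∉ γ₂ := fun hh => hy (hM₂ (hγ₂ hh))
    have hz₂ : z ∉ γ₂ := fun hh => hz (hM₂ (hγ₂ hh))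
    have hsec : apUpc q M₁ a m (fun γ₁ => splitInd y z (γ₁ ∪ γ₂) * h (γ₁ ∪ γ₂)) =
        apUpcSplit q M₁ a m y z (fun γ₁ => h (γ₁ ∪ γ₂)) := by
      rw [apUpcSplit_eq_apUpc]
      exact apUpc_congr q a m fun γ₁ _ => by rw [splitInd_union_right hy₂ hz₂]
    rw [hsec]
    obtain ⟨sy, sz⟩ := notRead_section hhy hhz γ₂
    refine mul_nonneg (pow_nonneg hq.le _) (mul_nonneg (apConn_nonneg _ _ _) (ih₁ _ (fun A B hAB hB => ?_) sy sz))
    exact hmono (Finset.union_subset_union hAB le_rfl) (Finset.union_subset_union hB hγ₂)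
  · rw [Finset.mem_powerset] at hγ₁
    have hsec : apUpc q M₂ m b (fun γ₂ => splitInd y z (γ₁ ∪ γ₂) * h (γ₁ ∪ γ₂)) =
        splitInd y z γ₁ * apUpc q M₂ m b (fun γ₂ => h (γ₁ ∪ γ₂)) := by
      rw [← apUpc_const_mul]
      refine apUpc_congr q m b fun γ₂ hγ₂ => ?_
      rw [splitInd_union_right (fun hh => hy (hM₂ (hγ₂ hh))) (fun hh => hz (hM₂ (hγ₂ hh)))]
    rw [hsec]
    refine mul_nonneg (pow_nonneg hq.le _) (mul_nonneg (apConn_nonneg _ _ _)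
      (mul_nonneg (splitInd_nonneg y z γ₁) (ih₂ _ fun A B hAB hB => ?_)))
    exact hmono (Finset.union_subset_union le_rfl hAB) (Finset.union_subset_union hγ₁ hB)

/-- **Series composition with an unmarked part on the left** (marked edges in the `(m, b)`-part `M₂`). [cite: Grimmett2006, §3.8 Thm. (3.90) (pp. 61–62)] -/
theorem apUpcSplit_series_right_nonneg {a m b : V} (hq : 0 < q) (hd : Disjoint E₁ E₂)
    (h₁ : ∀ e ∈ (↑E₁ : Set (Sym2 V)), ∀ x ∈ e, x ∈ V₁) (h₂ : ∀ e ∈ (↑E₂ : Set (Sym2 V)), ∀ x ∈ e, x ∈ V₂)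
    (hS : V₁ ∩ V₂ ⊆ {m}) (haV₂ : a ∉ V₂) (hbV₁ : b ∉ V₁) (ham : a ≠ m) (hbm : b ≠ m) (hab : a ≠ b)
    {M₁ M₂ : Finset (Sym2 V)} (hM₁ : M₁ ⊆ E₁) (hM₂ : M₂ ⊆ E₂) (hy : y ∉ E₁) (hz : z ∉ E₁)
    (ih₁ : ∀ h' : Finset (Sym2 V) → ℝ, (∀ ⦃A B : Finset (Sym2 V)⦄, A ⊆ B → B ⊆ M₁ → h' A ≤ h' B) → 0 ≤ apUpc q M₁ a m h')
    (ih₂ : ∀ h' : Finset (Sym2 V) → ℝ, (∀ ⦃A B : Finset (Sym2 V)⦄, A ⊆ B → B ⊆ M₂ → h' A ≤ h' B) →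
      (∀ A, h' (insert y A) = h' A) → (∀ A, h' (insert z A) = h' A) → 0 ≤ apUpcSplit q M₂ m b y z h')
    {h : Finset (Sym2 V) → ℝ} (hmono : ∀ ⦃A B : Finset (Sym2 V)⦄, A ⊆ B → B ⊆ M₁ ∪ M₂ → h A ≤ h B)
    (hhy : ∀ A, h (insert y A) = h A) (hhz : ∀ A, h (insert z A) = h A) :
    0 ≤ apUpcSplit q (M₁ ∪ M₂) a b y z h := by
  rw [apUpcSplit_eq_apUpc]
  have key := apUpc_series_eq q hd h₁ h₂ hS haV₂ hbV₁ ham hbm hab hM₁ hM₂ (fun γ => splitInd y z γ * h γ)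
  have hpos : 0 < q ^ (2 * Fintype.card V) := pow_pos hq _
  refine (mul_nonneg_iff_of_pos_left hpos).1 ?_
  rw [key]
  refine add_nonneg (Finset.sum_nonneg fun γ₂ hγ₂ => ?_) (Finset.sum_nonneg fun γ₁ hγ₁ => ?_)
  · rw [Finset.mem_powerset] at hγ₂
    have hsec : apUpc q M₁ a m (fun γ₁ => splitInd y z (γ₁ ∪ γ₂) * h (γ₁ ∪ γ₂)) =
        splitInd y z γ₂ * apUpc q M₁ a m (fun γ₁ => h (γ₁ ∪ γ₂)) := by
      rw [← apUpc_const_mul]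
      refine apUpc_congr q a m fun γ₁ hγ₁ => ?_
      rw [splitInd_union_left (fun hh => hy (hM₁ (hγ₁ hh))) (fun hh => hz (hM₁ (hγ₁ hh)))]
    rw [hsec]
    refine mul_nonneg (pow_nonneg hq.le _) (mul_nonneg (apConn_nonneg _ _ _)
      (mul_nonneg (splitInd_nonneg y z γ₂) (ih₁ _ fun A B hAB hB => ?_)))
    exact hmono (Finset.union_subset_union hAB le_rfl) (Finset.union_subset_union hB hγ₂)
  · rw [Finset.mem_powerset] at hγ₁
    have hy₁ : y ∉ γ₁ := fun hh => hy (hM₁ (hγ₁ hh))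
    have hz₁ : z ∉ γ₁ := fun hh => hz (hM₁ (hγ₁ hh))
    have hsec : apUpc q M₂ m b (fun γ₂ => splitInd y z (γ₁ ∪ γ₂) * h (γ₁ ∪ γ₂)) =
        apUpcSplit q M₂ m b y z (fun γ₂ => h (γ₁ ∪ γ₂)) := by
      rw [apUpcSplit_eq_apUpc]
      exact apUpc_congr q m b fun γ₂ _ => by rw [splitInd_union_left hy₁ hz₁]
    rw [hsec]
    obtain ⟨sy, sz⟩ := notRead_section' hhy hhz γ₁
    refine mul_nonneg (pow_nonneg hq.le _) (mul_nonneg (apConn_nonneg _ _ _) (ih₂ _ (fun A B hAB hB => ?_) sy sz))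
    exact hmono (Finset.union_subset_union le_rfl hAB) (Finset.union_subset_union hγ₁ hB)

end Compose

/-! ### Along a spine: from an inner composite to every network grown from it -/

section Grow

variable [Fintype V] {q : ℝ} {y z : Sym2 V}

omit [Fintype V] in
/-- `U¹¹` is symmetric in the terminals. [folklore] -/
theorem apUpcSplit_comm_terminals (q : ℝ) (E : Finset (Sym2 V)) (s t : V) (y z : Sym2 V) (h : Finset (Sym2 V) → ℝ) :
    apUpcSplit q E t s y z h = apUpcSplit q E s t y z h := by
  unfold apUpcSplit apConn
  refine Finset.sum_congr rfl fun γ _ => ?_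
  simp only [SimpleGraph.reachable_comm (u := t) (v := s)]

/-- **`U¹¹ ≥ 0` propagates along a spine.**  If the inner composite `(M; a, b)` (containing the marked edges `y, z`, with `a ≠ b`)
satisfies `U¹¹(M; h') ≥ 0` for every `h'` monotone on its sub-configurations and not reading `y, z`, then so does every network `(E; s, t)`
grown from it by gluing two-terminal series–parallel parts (`FK.IsSpine ps M a b E s t`), for every `q > 0`. [cite: Grimmett2006, §3.8 Thm. (3.90) (pp. 61–62)] -/
theorem IsSpine.apUpcSplit_nonneg (hq : 0 < q) {ps : List (SpinePart V)} {M E : Finset (Sym2 V)} {a b s t : V}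
    (hsp : IsSpine ps M a b E s t) (hab : a ≠ b) (hyM : y ∈ M) (hzM : z ∈ M)
    (core : ∀ h' : Finset (Sym2 V) → ℝ, (∀ ⦃A B : Finset (Sym2 V)⦄, A ⊆ B → B ⊆ M → h' A ≤ h' B) →
      (∀ A, h' (insert y A) = h' A) → (∀ A, h' (insert z A) = h' A) → 0 ≤ apUpcSplit q M a b y z h') :
    ∀ h : Finset (Sym2 V) → ℝ, (∀ ⦃A B : Finset (Sym2 V)⦄, A ⊆ B → B ⊆ E → h A ≤ h B) →
      (∀ A, h (insert y A) = h A) → (∀ A, h (insert z A) = h A) → 0 ≤ apUpcSplit q E s t y z h := by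
  induction ps generalizing M a b with
  | nil =>
    obtain ⟨rfl, rfl, rfl⟩ := hsp
    exact core
  | cons p ps ih =>
    obtain ⟨a', b', hg, hrest⟩ := hsp
    refine ih hrest (hg.ne hab) (Finset.mem_union_left _ hyM) (Finset.mem_union_left _ hzM) ?_
    -- one gluing step
    intro h' hmono hhy hhz
    have hyR : y ∉ p.R := fun hh => Finset.disjoint_left.1 hg.disjoint hyM hh
    have hzR : z ∉ p.R := fun hh => Finset.disjoint_left.1 hg.disjoint hzM hh
    cases hg with
    | @par M R a b hR hd hV =>
      exact apUpcSplit_parallel_nonneg hq hd (span_mem M) (span_mem R) (inter_span_subset_pair hV) hab subset_rfl subset_rfl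
        hyR hzR core (apUpc_nonneg_of_isTTSP hq hR R subset_rfl) hmono hhy hhz
    | @serA M R a b a' hR hd hV hb ha' =>
      have hS : {w : V | ∃ e ∈ R, w ∈ e} ∩ {w : V | ∃ e ∈ M, w ∈ e} ⊆ ({a} : Set V) := fun w hw => hV w hw.2 hw.1
      have ha'b : a' ≠ b := (ne_of_not_mem_span hb hR.right_mem).symm
      rw [Finset.union_comm]
      exact apUpcSplit_series_right_nonneg hq hd.symm (span_mem R) (span_mem M) hS
        (fun hh => by obtain ⟨e, he, hh⟩ := hh; exact ha' e he hh) (fun hh => by obtain ⟨e, he, hh⟩ := hh; exact hb e he hh)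
        hR.ne.symm hab.symm ha'b subset_rfl subset_rfl hyR hzR (apUpc_nonneg_of_isTTSP hq hR.symm R subset_rfl) core
        (fun A B hAB hB => hmono hAB (by rwa [Finset.union_comm] at hB)) hhy hhz
    | @serB M R a b b' hR hd hV ha hb' =>
      have hS : {w : V | ∃ e ∈ M, w ∈ e} ∩ {w : V | ∃ e ∈ R, w ∈ e} ⊆ ({b} : Set V) := fun w hw => hV w hw.1 hw.2
      have hab' : a ≠ b' := ne_of_not_mem_span ha hR.right_mem
      exact apUpcSplit_series_left_nonneg hq hd (span_mem M) (span_mem R) hS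
        (fun hh => by obtain ⟨e, he, hh⟩ := hh; exact ha e he hh) (fun hh => by obtain ⟨e, he, hh⟩ := hh; exact hb' e he hh)
        hab hR.ne.symm hab' subset_rfl subset_rfl hyR hzR core (apUpc_nonneg_of_isTTSP hq hR R subset_rfl) hmono hhy hhz

/-- **`U¹¹ ≥ 0` for every network grown from a pendant core** (`0 < q ≤ 1`): `M` two-terminal series–parallel between `s, t` with a marked
edge `z = uv ∈ M`, `y = s₀s` a pendant edge at `s` (`s₀` off `M`), and `(E; s', t')` any network obtained from `(y·M; s₀, t)` by gluing
two-terminal series–parallel parts (`FK.IsSpine`); then `0 ≤ apUpcSplit q E s' t' y z h` for every `h` monotone on the subsets of `E` and not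
reading `y, z` — the split up-correlation inequality `U¹¹` of memo g11 whenever the lowest decomposition node containing both marked edges
is a series node with the single edge `y` as a child. [cite: Grimmett2006, §3.9 (p. 63)] -/
theorem apUpcSplit_nonneg_of_pendant_core (hq0 : 0 < q) (hq1 : q ≤ 1) {M E : Finset (Sym2 V)} {s t u v s₀ s' t' : V}
    (hM : IsTTSP M s t) (huv : s(u, v) ∈ M) (hs₀ : ∀ e ∈ M, s₀ ∉ e) {ps : List (SpinePart V)}
    (hsp : IsSpine ps (insert s(s₀, s) M) s₀ t E s' t') {h : Finset (Sym2 V) → ℝ}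
    (hmono : ∀ ⦃A B : Finset (Sym2 V)⦄, A ⊆ B → B ⊆ E → h A ≤ h B)
    (hhy : ∀ A, h (insert s(s₀, s) A) = h A) (hhz : ∀ A, h (insert s(u, v) A) = h A) :
    0 ≤ apUpcSplit q E s' t' s(s₀, s) s(u, v) h := by
  have hs₀t : s₀ ≠ t := ne_of_not_mem_span hs₀ hM.right_mem
  refine hsp.apUpcSplit_nonneg hq0 hs₀t (Finset.mem_insert_self _ _) (Finset.mem_insert_of_mem huv) ?_ h hmono hhy hhz
  intro h' hmono' hhy' hhz'
  exact apUpcSplit_pendant_nonneg hq0 hq1 hM huv hs₀ (g := h') (fun A _ => hhy' A) (fun A _ => hhz' A)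
    fun A B hAB hB => hmono' hAB (hB.trans ((Finset.erase_subset _ _).trans (Finset.subset_insert _ _)))

end Grow

end FK

end Summit.CriticalPhenomena.PercolationContinuityZ3.Theorems

end
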